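import Summits.BirchSwinnertonDyer.BirchSwinnertonDyer.Theorems.PrintCf2SplitBadTwoRestrictedControlOfResiduals
import Summits.BirchSwinnertonDyer.BirchSwinnertonDyer.Theorems.PrintCf2SplitBadTwoControlCokernelTamagawaAll
import Summits.BirchSwinnertonDyer.BirchSwinnertonDyer.Theorems.PrintCf2SplitBadTwoRestrictedControlKernelResidual
import HarnessLib

/-!
# Crux `PrintCf2.SplitBadTwoRankOneOfFacts` (stmt-BirchSwinnertonDyer-20368), road α v10.3 — S3c assembly, SEVENTH CUT: (R-SURJ) CORRECTED
# `stub_restrictedControl_two` ⟸ (R-TOP′) ∧ (R-DYADIC) ∧ (R-SURJ″) ∧ (R-BV)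

Cell `bsd-print-cf2`, LEAD seat `bsd-line-cf2-p1` g12 (prover-bsd-line-cf2-p1-g12-0); `--supports stmt-BirchSwinnertonDyer-20368` (helper, Theses-free).
HONEST FRAMING: proves the registered statement of S3c from DISPLAYED HYPOTHESES; nothing here is a named fact; BSD is not proved by any of this; no
summit statement is proved by this seat. No definition, no `sorry`.

THE CORRECTION (credit: -w5 g3 `…RestrictedSelmerCokernelKernelIdentity`, `relIndex · #ker(res) = [A : 𝔖_𝔮(K, M)] · #(𝔖_𝔮(K, M) ⊓ ker res)` for the lift
subgroup `A = res⁻¹(𝔖^Γ)`). Cuts 2–6 asked for (R-SURJ) «`relIndex = ∏_{w∈T} #LK_w · #LK_{v̄}`». But `#ker(res : H¹(K, W*) → H¹(K*_∞, W*)) =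
#H¹(Γ, W*(K*_∞)) = 2` on every frame (LEAD g11 p656507: `W*(K*_∞) ≅ ℤ/2`, trivial action) while the control kernel `𝔖 ⊓ ker res` is TRIVIAL
(-w6 g2 `kerResidual_holds`), so `relIndex = [A : 𝔖(K)] / 2 = #im(A → ⊕ LK_w) / 2 ≤ (∏ #LK_w · #LK_{v̄}) / 2`: the hypothesis of cuts 2–6 is off by the
factor `2` and UNSATISFIABLE — those cuts are vacuous at (R-SURJ) (cut 1's combined (R-LEVELK) is unaffected: a class constant). This cut states the
cokernel law ROBUSTLY, as a class function: (R-SURJ″) «`v₂ [𝔖^Γ : res 𝔖(K)] = Σ_{w∈T} v₂ #LK_w + v₂ #LK_{v̄} + e_s([d]₂)`» (given `𝔖^Γ` finite);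
with the rank-one surjectivity (δ = 1, LEAD memo `S3C-DEFECT-VANISHES-g12.md`) `e_s ≡ −1`. The other three hypotheses are cut 6's verbatim:
(R-TOP′) [-w4 g9: ⟸ (β) ⟸ (LS)], (R-DYADIC) [-w2 g9], (R-BV) [-w7 g2 `rBV_of_three_factor_values`]; (C1), (R-KER), (R-SEVEN) discharged by name as in
cut 6. `e_C := e_K + e_{v̄} + e_s − e_k − e_Γ`. DISCHARGE AGAINST THIS CUT. presearch: not applicable. beyond-print theorem: no.

References: [Agboola2007] §3 Prop. 3.2, §5, §6 Prop. 6.10–6.11, Prop. 8.1; [GreenbergLNM1716] §3 Lemmas 3.1–3.3, §4 Lemma 4.2.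
-/

noncomputable section

open scoped Classical

set_option linter.dupNamespace false
set_option autoImplicit false

open NumberField IsDedekindDomain Field WeierstrassCurve
open Literature.NumberTheory.EllipticCurves Literature.NumberTheory.EllipticCurves.GreenbergSelmer
open Literature.NumberTheory.EllipticCurves.Agboola2007
open Literature.NumberTheory.EllipticCurves.IwasawaAlgebra
open Literature.NumberTheory.EllipticCurves.IwasawaDual
open Literature.NumberTheory.EllipticCurves.ResKernel
open Literature.NumberTheory.GaloisRepresentations
open Summit.BirchSwinnertonDyer.BirchSwinnertonDyer.Theorems.PrintCf2.AdditiveAtSeven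
open Summit.BirchSwinnertonDyer.BirchSwinnertonDyer.Theorems.GoldfeldGoodTwists

namespace Summit.BirchSwinnertonDyer.BirchSwinnertonDyer.Theorems.PrintCf2.RestrictedSelmerPair

/-- **S3c `stub_restrictedControl_two` — SEVENTH CUT: ⟸ (R-TOP′) ∧ (R-DYADIC) ∧ (R-SURJ″) ∧ (R-BV)**, the cokernel law as a CLASS FUNCTION
(`e_s`, `= −1` under δ = 1); (C1), (R-KER), (R-SEVEN) discharged by the tree theorems of -w3 g8 and -w6 g2; `e_C := e_K + e_{v̄} + e_s − e_k − e_Γ`. [cite: Agboola2007, §3 Prop. 3.2, §5, §6 Prop. 6.10–6.11, Prop. 8.1]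
[cite: GreenbergLNM1716, §3 Lemmas 3.1–3.3, §4 Lemma 4.2] -/
theorem restrictedControl_two_of_four_residuals'
    -- (R-TOP′) `v₂ #𝔖_Γ` is a function of the 2-adic class of `d` on every frame with a f.g. dual datum with a characteristic valuation
    -- (= 0 under B17 «no nonzero finite Λ-submodule», -w4 g8; stated as a class function so that the assembly survives either outcome at p = 2)
    (hTop : ∃ eΓ : ℤ → ℤ → ℤ, ∀ (d : ℤ), d ≠ 0 → Squarefree d → d % 4 ≠ 1 →
      ∀ (W : WeierstrassCurve ℚ) [W.IsElliptic] (C : VariableChange ℚ), C • W = cm7.quadraticTwist (d : ℚ) →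
      ∀ (K : Type) [Field K] [NumberField K], IsImaginaryQuadratic K →
      ∀ (v vbar : HeightOneSpectrum (𝓞 K)),
        ((2 : ℕ) : 𝓞 K) ∈ v.asIdeal → ((2 : ℕ) : 𝓞 K) ∈ vbar.asIdeal → vbar ≠ v →
      ∀ (π : (W.baseChange K).endRing), (π : AddMonoid.End (W.baseChange K).geomPoints) * π = π - 2 →
      ∀ (r : ℤ_[2]), r * r = r - 2 →
        (∀ τ ∈ GreenbergSelmer.inertia v, ∀ x : ↥((W.baseChange K).endEigenPrimaryTorsion 2 π r), τ • x = x ∨ τ • x = -x) →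
      ∀ (κ' : ZpExtension K 2), κ'.IsUnramifiedOutside vbar → ∀ (γ' : absoluteGaloisGroup K), κ'.IsTopGenerator γ' →
      ∀ (D : Agboola2007.RestrictedDualData κ' ↥((W.baseChange K).endEigenPrimaryTorsion 2 π r) vbar γ') (n : ℕ),
        Module.Finite (IwasawaAlgebra 2) D.X → D.HasCharValuationAt n →
        (padicValNat 2 (Nat.card (EndCoinvariants (conjRestricted κ' ↥((W.baseChange K).endEigenPrimaryTorsion 2 π r) vbar γ' - 1))) : ℤ) =
          eΓ (d % 2) ((d / (2 - d % 2)) % 8))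
    (hDy : ∃ ev : ℤ → ℤ → ℤ, ∀ (d : ℤ), d ≠ 0 → Squarefree d → d % 4 ≠ 1 →
      ∀ (W : WeierstrassCurve ℚ) [W.IsElliptic] (C : VariableChange ℚ), C • W = cm7.quadraticTwist (d : ℚ) →
      ∀ (K : Type) [Field K] [NumberField K], IsImaginaryQuadratic K →
      ∀ (v vbar : HeightOneSpectrum (𝓞 K)),
        ((2 : ℕ) : 𝓞 K) ∈ v.asIdeal → ((2 : ℕ) : 𝓞 K) ∈ vbar.asIdeal → vbar ≠ v →
      ∀ (π : (W.baseChange K).endRing), (π : AddMonoid.End (W.baseChange K).geomPoints) * π = π - 2 →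
      ∀ (r : ℤ_[2]), r * r = r - 2 →
        (∀ τ ∈ GreenbergSelmer.inertia v, ∀ x : ↥((W.baseChange K).endEigenPrimaryTorsion 2 π r), τ • x = x ∨ τ • x = -x) →
      ∀ (κ' : ZpExtension K 2), κ'.IsUnramifiedOutside vbar →
        (padicValNat 2 (Nat.card (resOfLe ↥((W.baseChange K).endEigenPrimaryTorsion 2 π r)
          (inf_le_inf_right (decomp vbar) (le_top : κ'.kerSubgroup ≤ ⊤))).ker) : ℤ) = ev (d % 2) ((d / (2 - d % 2)) % 8))
    -- (R-SURJ″) the control cokernel is the product of the local kernels UP TO A CLASS CONSTANT `e_s([d]₂)` (with -w5 g3's identity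
    -- `relIndex · #ker(res) = [A : 𝔖(K)] · #(𝔖(K) ⊓ ker res)`, `#ker(res) = 2` (p656507) and `#(𝔖(K) ⊓ ker res) = 1` (kerResidual), surjectivity of
    -- the lift map `A → ⊕ LK_w` — the rank-one vanishing δ = 1 — gives `e_s ≡ −1`; cuts 2–6 asked for `relIndex = ∏`, off by this factor 2)
    (hSurj : ∃ es : ℤ → ℤ → ℤ, ∀ (d : ℤ), d ≠ 0 → Squarefree d → d % 4 ≠ 1 →
      ∀ (W : WeierstrassCurve ℚ) [W.IsElliptic] [W.IsGloballyMinimal] (C : VariableChange ℚ),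
        C • W = cm7.quadraticTwist (d : ℚ) → W.analyticRank = 1 →
      ∀ (K : Type) [Field K] [NumberField K], IsImaginaryQuadratic K →
      ∀ (v vbar : HeightOneSpectrum (𝓞 K)),
        ((2 : ℕ) : 𝓞 K) ∈ v.asIdeal → ((2 : ℕ) : 𝓞 K) ∈ vbar.asIdeal → vbar ≠ v →
      ∀ (π : (W.baseChange K).endRing), (π : AddMonoid.End (W.baseChange K).geomPoints) * π = π - 2 →
      ∀ (r : ℤ_[2]), r * r = r - 2 →
        (∀ τ ∈ GreenbergSelmer.inertia v, ∀ x : ↥((W.baseChange K).endEigenPrimaryTorsion 2 π r), τ • x = x ∨ τ • x = -x) →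
      ∀ (κ' : ZpExtension K 2), κ'.IsUnramifiedOutside vbar → ∀ (γ' : absoluteGaloisGroup K), κ'.IsTopGenerator γ' →
      Finite (endInvariants (conjRestricted κ' ↥((W.baseChange K).endEigenPrimaryTorsion 2 π r) vbar γ' - 1)) →
      ∀ (T : Finset (HeightOneSpectrum (𝓞 K))),
        (∀ w : HeightOneSpectrum (𝓞 K), w ∈ T ↔ ((2 : ℕ) : 𝓞 K) ∉ w.asIdeal ∧ ((7 * d : ℤ) : 𝓞 K) ∈ w.asIdeal) →
        (padicValNat 2 ((((restrictedSelmerBase ↥((W.baseChange K).endEigenPrimaryTorsion 2 π r) 2 vbar).map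
            (resOfLe ↥((W.baseChange K).endEigenPrimaryTorsion 2 π r) (le_top : κ'.kerSubgroup ≤ ⊤))).addSubgroupOf
            (restrictedSelmerZp κ' ↥((W.baseChange K).endEigenPrimaryTorsion 2 π r) vbar)).relIndex
          (endInvariants (conjRestricted κ' ↥((W.baseChange K).endEigenPrimaryTorsion 2 π r) vbar γ' - 1))) : ℤ) =
        (∑ w ∈ T, padicValNat 2 (Nat.card (resOfLe ↥((W.baseChange K).endEigenPrimaryTorsion 2 π r) (inf_le_inf_right (decomp w) (le_top : κ'.kerSubgroup ≤ ⊤))).ker) : ℕ) +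
          padicValNat 2 (Nat.card (resOfLe ↥((W.baseChange K).endEigenPrimaryTorsion 2 π r) (inf_le_inf_right (decomp vbar) (le_top : κ'.kerSubgroup ≤ ⊤))).ker) +
          es (d % 2) ((d / (2 - d % 2)) % 8))
    -- (R-BV) the BOTTOM VALUE law: `v₂ #𝔖_{v̄}(K, W*) = v₂ #Ш(W/ℚ)[2^∞] + 2ℓ + e_K([d]₂)` (Agboola Prop. 6.10–6.11 + 8.1 at the additive prime)
    (hBV : ∃ eK : ℤ → ℤ → ℤ, ∀ (d : ℤ), d ≠ 0 → Squarefree d → d % 4 ≠ 1 →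
      ∀ (W : WeierstrassCurve ℚ) [W.IsElliptic] [W.IsGloballyMinimal] (C : VariableChange ℚ),
        C • W = cm7.quadraticTwist (d : ℚ) → W.analyticRank = 1 →
      ∀ (K : Type) [Field K] [NumberField K], IsImaginaryQuadratic K →
      ∀ (v vbar : HeightOneSpectrum (𝓞 K)),
        ((2 : ℕ) : 𝓞 K) ∈ v.asIdeal → ((2 : ℕ) : 𝓞 K) ∈ vbar.asIdeal → vbar ≠ v →
      ∀ (π : (W.baseChange K).endRing), (π : AddMonoid.End (W.baseChange K).geomPoints) * π = π - 2 →
      ∀ (r : ℤ_[2]), r * r = r - 2 →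
        (∀ τ ∈ GreenbergSelmer.inertia v, ∀ x : ↥((W.baseChange K).endEigenPrimaryTorsion 2 π r), τ • x = x ∨ τ • x = -x) →
      ∀ (P : W.toAffine.Point) (c₀ : ℕ) (ℓ : ℤ),
        ¬ IsOfFinAddOrder P →
        (∀ R : W.toAffine.Point, ∃ (k : ℤ) (T : W.toAffine.Point), IsOfFinAddOrder T ∧ R = k • P + T) →
        c₀ ≠ 0 → (W.baseChange ℚ_[2]).IsInReductionKernel (c₀ • W.toPadicPoint 2 P) →
        ‖(W.baseChange ℚ_[2]).padicLogPoint (c₀ • W.toPadicPoint 2 P) / (c₀ : ℚ_[2])‖ = (2 : ℝ) ^ (-ℓ) →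
      Finite (restrictedSelmerBase ↥((W.baseChange K).endEigenPrimaryTorsion 2 π r) 2 vbar) →
        (padicValNat 2 (Nat.card (restrictedSelmerBase ↥((W.baseChange K).endEigenPrimaryTorsion 2 π r) 2 vbar)) : ℤ) =
          (padicValNat 2 (Nat.card (AddCommGroup.primaryComponent W.sha 2)) : ℤ) + 2 * ℓ + eK (d % 2) ((d / (2 - d % 2)) % 8)) :
    -- CONCLUSION: S3c `stub_restrictedControl_two`, v9 = v10.3 VERBATIM
    -- CONCLUSION: S3c `stub_restrictedControl_two`, v9 = v10.3 VERBATIM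
    ∃ eC : ℤ → ℤ → ℤ,
    ∀ (d : ℤ), d ≠ 0 → Squarefree d → d % 4 ≠ 1 →
    ∀ (W : WeierstrassCurve ℚ) [W.IsElliptic] [W.IsGloballyMinimal] (C : VariableChange ℚ),
      C • W = cm7.quadraticTwist (d : ℚ) → W.analyticRank = 1 →
    ∀ (K : Type) [Field K] [NumberField K], IsImaginaryQuadratic K →
    ∀ (v vbar : HeightOneSpectrum (𝓞 K)),
      ((2 : ℕ) : 𝓞 K) ∈ v.asIdeal → ((2 : ℕ) : 𝓞 K) ∈ vbar.asIdeal → vbar ≠ v →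
    ∀ (π : (W.baseChange K).endRing), (π : AddMonoid.End (W.baseChange K).geomPoints) * π = π - 2 →
    ∀ (r : ℤ_[2]), r * r = r - 2 →
      (∀ τ ∈ GreenbergSelmer.inertia v, ∀ x : ↥((W.baseChange K).endEigenPrimaryTorsion 2 π r), τ • x = x ∨ τ • x = -x) →
    ∀ (κ' : ZpExtension K 2), κ'.IsUnramifiedOutside vbar → ∀ (γ' : absoluteGaloisGroup K), κ'.IsTopGenerator γ' →
    ∀ (D : Agboola2007.RestrictedDualData κ' ↥((W.baseChange K).endEigenPrimaryTorsion 2 π r) vbar γ') (n : ℕ),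
      Module.Finite (IwasawaAlgebra 2) D.X → D.HasCharValuationAt n →
    ∀ (P : W.toAffine.Point) (c₀ : ℕ) (ℓ : ℤ),
      ¬ IsOfFinAddOrder P →
      (∀ R : W.toAffine.Point, ∃ (k : ℤ) (T : W.toAffine.Point), IsOfFinAddOrder T ∧ R = k • P + T) →
      c₀ ≠ 0 → (W.baseChange ℚ_[2]).IsInReductionKernel (c₀ • W.toPadicPoint 2 P) →
      ‖(W.baseChange ℚ_[2]).padicLogPoint (c₀ • W.toPadicPoint 2 P) / (c₀ : ℚ_[2])‖ = (2 : ℝ) ^ (-ℓ) →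
      (n : ℤ) = ((padicValNat 2 (Nat.card (AddCommGroup.primaryComponent W.sha 2)) : ℤ)
            + (padicValNat 2 W.tamagawaProduct : ℤ)
            - 2 * (padicValNat 2 W.torsionOrder : ℤ) + 2 * ℓ) + eC (d % 2) ((d / (2 - d % 2)) % 8) := by
  obtain ⟨ek, hek⟩ := kerResidual_holds
  obtain ⟨eΓ, heΓ⟩ := hTop
  obtain ⟨ev, hev⟩ := hDy
  obtain ⟨eK, heK⟩ := hBV
  obtain ⟨es, hes⟩ := hSurj
  refine ⟨fun a b ↦ eK a b + ev a b + es a b - ek a b - eΓ a b, ?_⟩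
  intro d hd0 hsq hd4 W _ _ C hC hrk K _ _ hK v vbar hv hvbar hne π hrel r hr hpin κ' hκ' γ' hγ' D n hDf hDn
    P c₀ ℓ hP hgen hc₀ hker hlog
  haveI : (W.baseChange K).IsElliptic := inferInstanceAs ((W.map (algebraMap ℚ K)).IsElliptic)
  haveI := hDf
  -- 1. the four-index identity with all finiteness
  obtain ⟨hfinI, hfinC, hfinB, hfinK, hid⟩ :=
    hasCharValuationAt_control_identity_endEigenPrimaryTorsion (W.baseChange K) 2 π r κ' hγ' vbar D hDn
  -- 2./3. kernel and top terms as class functions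
  have hkerZ := hek d hd0 hsq hd4 W C hC K hK v vbar hv hvbar hne π hrel r hr hpin κ' hκ' γ' hγ'
  have htopZ := heΓ d hd0 hsq hd4 W C hC K hK v vbar hv hvbar hne π hrel r hr hpin κ' hκ' γ' hγ' D n hDf hDn
  -- 4. places `T`, Tamagawa dictionary, torsion
  obtain ⟨T, hT⟩ := exists_finset_seven_mul (K := K) hd0
  have hC1T : ∀ w ∈ T, ¬ decomp w ≤ κ'.kerSubgroup := fun w hw ↦
    LineDecomposition.decomp_not_le_kerSubgroup_of_isUnramifiedOutside hK hv hvbar hne κ' hκ'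
      (fun h ↦ ((hT w).mp hw).1 (h ▸ hvbar))
  have hTam : (∑ w ∈ T, padicValNat 2 (Nat.card (resOfLe ↥((W.baseChange K).endEigenPrimaryTorsion 2 π r) (inf_le_inf_right (decomp w) (le_top : κ'.kerSubgroup ≤ ⊤))).ker)) + 2 =
      padicValNat 2 W.tamagawaProduct ∧ W.torsionOrder = 2 := by
    by_cases h7 : (7 : ℤ) ∣ d
    · obtain ⟨htors, hlaw⟩ := TamagawaPlaces.rSeven_cut4 d hsq hd4 h7 W C hC
      exact ⟨hlaw K hK vbar hvbar π hrel r hr κ' hκ' T hT hC1T, htors⟩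
    · exact ⟨sum_padicValNat_localKer_top_of_frame_add_two_eq hsq hd4 h7 W C hC hK vbar hvbar π hrel hr κ' hκ' T hT hC1T,
        torsionOrder_eq_two_of_smul_eq_cm7_quadraticTwist hsq hd4 h7 W C hC⟩
  obtain ⟨hTamEq, htors⟩ := hTam
  -- 5. dyadic value, 6. exact cokernel and bottom value
  have hdy := hev d hd0 hsq hd4 W C hC K hK v vbar hv hvbar hne π hrel r hr hpin κ' hκ'
  have hsurj := hes d hd0 hsq hd4 W C hC hrk K hK v vbar hv hvbar hne π hrel r hr hpin κ' hκ' γ' hγ' hfinI T hT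
  have hbv := heK d hd0 hsq hd4 W C hC hrk K hK v vbar hv hvbar hne π hrel r hr hpin P c₀ ℓ hP hgen hc₀ hker hlog hfinB
  -- 7. arithmetic
  have htors2 : (padicValNat 2 W.torsionOrder : ℤ) = 1 := by
    rw [htors]; simp
  have hidZ := congrArg (fun m : ℕ ↦ (m : ℤ)) hid
  have hTamZ := congrArg (fun m : ℕ ↦ (m : ℤ)) hTamEq
  dsimp only at hidZ hTamZ ⊢
  push_cast at hidZ hTamZ hsurj hbv hdy hkerZ htopZ htors2 ⊢
  linarith

end Summit.BirchSwinnertonDyer.BirchSwinnertonDyer.Theorems.PrintCf2.RestrictedSelmerPair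

end
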